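import Mathlib
import Summits.ValiantsHypothesis.ValiantsHypothesis.Theorems.BarrierLeverPartitionMinorsHitByVPHiddenStatesFullJoinPrep
import Summits.ValiantsHypothesis.ValiantsHypothesis.Theorems.BarrierLeverPartitionMinorsHitByVPHiddenStatesFullJoinSplit
import Summits.ValiantsHypothesis.ValiantsHypothesis.Theorems.BarrierLeverPartitionMinorsHitByVPHiddenStatesFullJoinDiag
import Summits.ValiantsHypothesis.ValiantsHypothesis.Theorems.BarrierLeverPartitionMinorsHitByVPHiddenStatesFullJoinLeaf

/-!
# Route BarrierLever — item `PartitionMinorsHitByVP` (stmt-ValiantsHypothesis-19717), line `hidden_states`: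
# CONJECTURE FJ FOR ALL FIRST-SHELL PAIRS — `(B_s(C) ∪ {X}, B_s(C) ∪ {Y})` by the equal-link induction

Helper file (`--supports stmt-ValiantsHypothesis-19717`; cell valiant-natproofs, rung V4, 𝒟-side door (c), line
`Cruxes/PartitionMinorsHitByVP/Lines/hidden_states.lean` v8; prover seat val-np-p3 gen 16). Definition-free. Closes NO item.

THE POINT (memo val-np-p3 g16 «full join» §9, §12). First infinite family of NON-isomorphic lower pairs for which conjecture FJ is a
kernel theorem, obtained purely from the toolkit: for every coordinate set `C ⊆ Fin h`, radius `s`, and `(s+1)`-subsets `X, Y ⊆ C`, the pair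
of lower families `B_s(C) ∪ {X}` and `B_s(C) ∪ {Y}` (`B_s(C)` = subsets of `C` of size ≤ s; ANY injective enumerations) has a nonsingular
one-cube full hidden sum with `h + |X ∖ Y|` states (`fullJoinCube_firstShell`). PROOF = induction on `|X ∖ Y|`: if `X = Y` the pair is
diagonal (p673836 + `fullJoinCube_of_range_eq`); otherwise cut at `a ∈ X ∖ Y` (rows) and `b ∈ Y ∖ X` (columns): the deletion families are
the balls `B_s(C ∖ a)`, `B_s(C ∖ b)` — isomorphic by the transposition `(a b)` (diagonal + `fullJoin_relabel`, p676375) — and the link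
families are `B_{s−1}(C ∖ a) ∪ {X ∖ a}`, `B_{s−1}(C ∖ b) ∪ {Y ∖ b}`, a first-shell pair again after the same transposition, with
`|(X∖a) ∖ (Y∖b)| = |X ∖ Y| − 1`; the equal-link step `fullJoinCube_step_of_ranges` (p676301) assembles, `fullJoinCube_pad` (p676650) aligns the
state counts, and `s = 0` is a star leaf (p675793). Through the door (p672458) every such layout is hit inside `SmallCircuits ℂ (h+h) 8` by
a one-cube witness with `≤ 2h` states (`partitionMinor_hit_firstShell`, via the one-cube bridge `partitionMinor_hit_of_oneCube`).

WHAT THIS IS NOT: the general conjecture FJ stays open; item 19717 stays OPEN; nothing on crux 14610 or VP ≠ VNP.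
-/

set_option linter.dupNamespace false

namespace Summit.ValiantsHypothesis.ValiantsHypothesis.Theorems.BarrierLever.HiddenStates

open Finset Matrix

noncomputable section

namespace FullJoin

variable {h : ℕ}

/-! ## 1. Bookkeeping on the families `B_s(C) ∪ {X}` -/

/-- Membership in the ball family. -/
theorem mem_ballF {C : Finset (Fin h)} {s : ℕ} {U : Finset (Fin h)} :
    U ∈ (C.powerset.filter fun U => U.card ≤ s) ↔ U ⊆ C ∧ U.card ≤ s := by
  rw [Finset.mem_filter, Finset.mem_powerset]

/-- `B_s(C) ∪ {X}` is a lower family when `X ⊆ C` and `|X| = s + 1`. -/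
theorem isLowerSet_firstShell (C X : Finset (Fin h)) (s : ℕ) (hXC : X ⊆ C) (hX : X.card = s + 1) :
    IsLowerSet ((↑(insert X (C.powerset.filter fun U => U.card ≤ s)) : Set (Finset (Fin h)))) := by
  intro U V hVU hU
  rw [Finset.mem_coe, Finset.mem_insert, mem_ballF] at hU ⊢
  rcases hU with rfl | ⟨hUC, hUs⟩
  · by_cases hVU' : V = U
    · exact Or.inl hVU'
    · right
      refine ⟨hVU.trans hXC, ?_⟩
      have hlt : V.card < U.card := Finset.card_lt_card (lt_of_le_of_ne hVU hVU')
      omega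
  · exact Or.inr ⟨hVU.trans hUC, (Finset.card_le_card hVU).trans hUs⟩

/-- The deletion family at `a ∈ X`: the members avoiding `a` form the ball `B_s(C ∖ a)`. -/
theorem deletion_firstShell (C X : Finset (Fin h)) (s : ℕ) (a : Fin h) (haX : a ∈ X) :
    {U | U ∈ ((↑(insert X (C.powerset.filter fun U => U.card ≤ s)) : Set (Finset (Fin h)))) ∧ a ∉ U} =
      ↑((C.erase a).powerset.filter fun U => U.card ≤ s) := by
  ext U
  simp only [Set.mem_setOf_eq, Finset.coe_insert, Set.mem_insert_iff, Finset.mem_coe, mem_ballF, Finset.subset_erase]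
  constructor
  · rintro ⟨rfl | ⟨hUC, hUs⟩, haU⟩
    · exact absurd haX haU
    · exact ⟨⟨hUC, haU⟩, hUs⟩
  · rintro ⟨⟨hUC, haU⟩, hUs⟩
    exact ⟨Or.inr ⟨hUC, hUs⟩, haU⟩

/-- The link family at `a ∈ X` (`s ≥ 1`): `{U ∖ a : a ∈ U}` is `B_{s−1}(C ∖ a) ∪ {X ∖ a}`. -/
theorem link_firstShell (C X : Finset (Fin h)) (s : ℕ) (a : Fin h) (haX : a ∈ X) (hXC : X ⊆ C) :
    (fun U => U.erase a) '' {U | U ∈ ((↑(insert X (C.powerset.filter fun U => U.card ≤ s + 1)) : Set (Finset (Fin h)))) ∧ a ∈ U} =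
      ↑(insert (X.erase a) ((C.erase a).powerset.filter fun U => U.card ≤ s)) := by
  ext V
  simp only [Set.mem_image, Set.mem_setOf_eq, Finset.coe_insert, Set.mem_insert_iff, Finset.mem_coe, mem_ballF,
    Finset.subset_erase]
  constructor
  · rintro ⟨U, ⟨rfl | ⟨hUC, hUs⟩, haU⟩, rfl⟩
    · exact Or.inl rfl
    · right
      refine ⟨⟨(Finset.erase_subset a U).trans hUC, Finset.notMem_erase a U⟩, ?_⟩
      have := Finset.card_erase_of_mem haU
      omega
  · rintro (rfl | ⟨⟨hVC, haV⟩, hVs⟩)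
    · exact ⟨X, ⟨Or.inl rfl, haX⟩, rfl⟩
    · refine ⟨insert a V, ⟨Or.inr ⟨?_, ?_⟩, Finset.mem_insert_self a V⟩, Finset.erase_insert haV⟩
      · exact Finset.insert_subset (hXC haX) hVC
      · rw [Finset.card_insert_of_notMem haV]; omega

/-- Relabelling a ball by a permutation of the coordinates. -/
theorem map_ballF (σ : Equiv.Perm (Fin h)) (C : Finset (Fin h)) (s : ℕ) :
    ((C.powerset.filter fun U => U.card ≤ s).map (Finset.mapEmbedding σ.toEmbedding).toEmbedding) =
      ((C.map σ.toEmbedding).powerset.filter fun U => U.card ≤ s) := by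
  ext V
  simp only [Finset.mem_map, mem_ballF, RelEmbedding.coe_toEmbedding, Finset.mapEmbedding_apply]
  constructor
  · rintro ⟨U, ⟨hUC, hUs⟩, rfl⟩
    exact ⟨Finset.map_subset_map.mpr hUC, by rw [Finset.card_map]; exact hUs⟩
  · rintro ⟨hVC, hVs⟩
    refine ⟨V.map σ.symm.toEmbedding, ⟨?_, ?_⟩, ?_⟩
    · intro x hx
      rw [Finset.mem_map] at hx
      obtain ⟨y, hy, rfl⟩ := hx
      have := hVC hy
      rw [Finset.mem_map] at this
      obtain ⟨z, hz, rfl⟩ := this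
      simpa using hz
    · rw [Finset.card_map]; exact hVs
    · rw [Finset.map_map]
      convert Finset.map_refl (s := V) using 2
      ext x
      simp

/-- The transposition `(a b)` maps `C ∖ b` onto `C ∖ a` when `a, b ∈ C`. -/
theorem map_swap_erase (C : Finset (Fin h)) (a b : Fin h) (ha : a ∈ C) (hb : b ∈ C) :
    (C.erase b).map (Equiv.swap a b).toEmbedding = C.erase a := by
  ext x
  simp only [Finset.mem_map, Equiv.toEmbedding_apply, Finset.mem_erase]
  constructor
  · rintro ⟨y, ⟨hyb, hyC⟩, rfl⟩
    by_cases hya : y = a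
    · subst hya; rw [Equiv.swap_apply_left]; exact ⟨fun h' => hyb h'.symm, hb⟩
    · rw [Equiv.swap_apply_of_ne_of_ne hya hyb]; exact ⟨hya, hyC⟩
  · rintro ⟨hxa, hxC⟩
    by_cases hxb : x = b
    · subst hxb; exact ⟨a, ⟨fun h' => hxa h'.symm, ha⟩, Equiv.swap_apply_left a x⟩
    · exact ⟨x, ⟨hxb, hxC⟩, Equiv.swap_apply_of_ne_of_ne hxa hxb⟩

/-- A set avoiding `a` and `b` is fixed by the transposition. -/
theorem map_swap_of_notMem (V : Finset (Fin h)) (a b : Fin h) (ha : a ∉ V) (hb : b ∉ V) :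
    V.map (Equiv.swap a b).toEmbedding = V := by
  ext x
  simp only [Finset.mem_map, Equiv.toEmbedding_apply]
  constructor
  · rintro ⟨y, hy, rfl⟩
    rw [Equiv.swap_apply_of_ne_of_ne (fun h' => ha (by rw [← h']; exact hy)) (fun h' => hb (by rw [← h']; exact hy))]
    exact hy
  · intro hx
    exact ⟨x, hx, Equiv.swap_apply_of_ne_of_ne (fun h' => ha (by rw [← h']; exact hx)) (fun h' => hb (by rw [← h']; exact hx))⟩

/-- An injective enumeration of a finite family of sets (by `equivFin`). -/
theorem exists_enum (F : Finset (Finset (Fin h))) :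
    ∃ e : Fin F.card → Finset (Fin h), Function.Injective e ∧ Set.range e = ↑F := by
  refine ⟨fun i => (F.equivFin.symm i).1, fun i j hij => F.equivFin.symm.injective (Subtype.ext hij), ?_⟩
  ext U
  constructor
  · rintro ⟨i, rfl⟩; exact (F.equivFin.symm i).2
  · intro hU; exact ⟨F.equivFin ⟨U, hU⟩, by simp⟩

variable {K : ℕ}

/-- Padding to any larger number of states. -/
theorem fullJoinCube_pad_le {r : ℕ} (u w : Fin r → Finset (Fin h)) {K K' : ℕ} (hKK' : K ≤ K')
    (H : ∃ (tx ty : Option (Fin K) → Fin h → ℂ) (lam : Fin K → ℂ),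
      (Matrix.of fun i j : Fin r => ∑ J : Finset (Fin K), (∏ q ∈ J, lam q) *
        ((∏ a ∈ u i, (tx none a + ∑ q ∈ J, tx (some q) a)) * ∏ c ∈ w j, (ty none c + ∑ q ∈ J, ty (some q) c))).det ≠ 0) :
    ∃ (tx ty : Option (Fin K') → Fin h → ℂ) (lam : Fin K' → ℂ),
      (Matrix.of fun i j : Fin r => ∑ J : Finset (Fin K'), (∏ q ∈ J, lam q) *
        ((∏ a ∈ u i, (tx none a + ∑ q ∈ J, tx (some q) a)) * ∏ c ∈ w j, (ty none c + ∑ q ∈ J, ty (some q) c))).det ≠ 0 := by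
  induction K', hKK' using Nat.le_induction with
  | base => exact H
  | succ K' _ ih => exact fullJoinCube_pad u w ih

/-- **FJ for a RELABELLED pair of families (range form).** If FJ holds for every enumeration pair of the families `F`, `G`, it holds for
every enumeration pair of `F` and `G.map σ` (relabel only the `w`-side). -/
theorem fullJoinCube_relabel_range {r : ℕ} (σ : Equiv.Perm (Fin h)) (u w w' : Fin r → Finset (Fin h))
    (hu : Function.Injective u) (hw' : Function.Injective w')
    (hrange : Set.range w' = (fun W => W.map σ.toEmbedding) '' Set.range w)
    (H : ∃ (tx ty : Option (Fin K) → Fin h → ℂ) (lam : Fin K → ℂ),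
      (Matrix.of fun i j : Fin r => ∑ J : Finset (Fin K), (∏ q ∈ J, lam q) *
        ((∏ a ∈ u i, (tx none a + ∑ q ∈ J, tx (some q) a)) * ∏ c ∈ w j, (ty none c + ∑ q ∈ J, ty (some q) c))).det ≠ 0) :
    ∃ (tx ty : Option (Fin K) → Fin h → ℂ) (lam : Fin K → ℂ),
      (Matrix.of fun i j : Fin r => ∑ J : Finset (Fin K), (∏ q ∈ J, lam q) *
        ((∏ a ∈ u i, (tx none a + ∑ q ∈ J, tx (some q) a)) * ∏ c ∈ w' j, (ty none c + ∑ q ∈ J, ty (some q) c))).det ≠ 0 := by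
  have H1 := fullJoin_relabel u w (Equiv.refl _) σ u (fun j => (w j).map σ.toEmbedding)
    (fun i => by simp [Finset.map_refl, Equiv.refl_toEmbedding]) (fun j => rfl) H
  refine fullJoinCube_of_range_eq u (fun j => (w j).map σ.toEmbedding) u w' hu hw' rfl ?_ H1
  rw [hrange, ← Set.range_comp]
  rfl


/-! ## 2. The first-shell theorem -/

/-- The image of a family under relabelling by `σ`, as a set. -/
theorem coe_map_mapEmbedding (σ : Equiv.Perm (Fin h)) (F : Finset (Finset (Fin h))) :
    ((↑(F.map (Finset.mapEmbedding σ.toEmbedding).toEmbedding)) : Set (Finset (Fin h))) =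
      (fun W : Finset (Fin h) => W.map σ.toEmbedding) '' ↑F := by
  rw [Finset.coe_map]
  rfl

/-- The diagonal pair `(u, u)` satisfies FJ with `K = h` states (p673836, repackaged with the tables existentially quantified). -/
theorem fullJoinCube_diagK {r : ℕ} (u : Fin r → Finset (Fin h)) (hu : Function.Injective u) :
    ∃ (tx ty : Option (Fin h) → Fin h → ℂ) (lam : Fin h → ℂ),
      (Matrix.of fun i j : Fin r => ∑ J : Finset (Fin h), (∏ q ∈ J, lam q) *
        ((∏ a ∈ u i, (tx none a + ∑ q ∈ J, tx (some q) a)) *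
          ∏ c ∈ u j, (ty none c + ∑ q ∈ J, ty (some q) c))).det ≠ 0 :=
  ⟨fun o b => (o.elim 0 fun q => if q = b then 1 else 0 : ℂ), fun o b => (o.elim 0 fun q => if q = b then 1 else 0 : ℂ),
    fun _ => 1, fullJoinCube_diag_det_ne_zero u hu⟩

/-- **CONJECTURE FJ FOR ALL FIRST-SHELL PAIRS.** For every coordinate set `C`, radius `s`, `(s+1)`-subsets `X, Y ⊆ C` and every pair of
injective enumerations `u`, `w` of the lower families `B_s(C) ∪ {X}`, `B_s(C) ∪ {Y}`, the one-cube full hidden sum is nonsingular for some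
table with `h + |X ∖ Y|` states. -/
theorem fullJoinCube_firstShell (n : ℕ) :
    ∀ (s : ℕ) (C X Y : Finset (Fin h)), X ⊆ C → Y ⊆ C → X.card = s + 1 → Y.card = s + 1 → (X \ Y).card = n →
      ∀ (r : ℕ) (u w : Fin r → Finset (Fin h)), Function.Injective u → Function.Injective w →
        Set.range u = ↑(insert X (C.powerset.filter fun U => U.card ≤ s)) →
        Set.range w = ↑(insert Y (C.powerset.filter fun U => U.card ≤ s)) →
        ∃ (tx ty : Option (Fin (h + n)) → Fin h → ℂ) (lam : Fin (h + n) → ℂ),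
          (Matrix.of fun i j : Fin r => ∑ J : Finset (Fin (h + n)), (∏ q ∈ J, lam q) *
            ((∏ a ∈ u i, (tx none a + ∑ q ∈ J, tx (some q) a)) *
              ∏ c ∈ w j, (ty none c + ∑ q ∈ J, ty (some q) c))).det ≠ 0 := by
  classical
  induction n with
  | zero =>
    intro s C X Y hXC hYC hX hY hXY r u w hu hw hru hrw
    -- `X = Y`: the pair is diagonal
    have hXY' : X = Y := by
      have hsub : X ⊆ Y := Finset.sdiff_eq_empty_iff_subset.mp (Finset.card_eq_zero.mp hXY)
      exact Finset.eq_of_subset_of_card_le hsub (by omega)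
    subst hXY'
    refine fullJoinCube_of_range_eq u u u w hu hw rfl (by rw [hrw, hru]) ?_
    exact fullJoinCube_diagK u hu
  | succ n ih =>
    intro s C X Y hXC hYC hX hY hXY r u w hu hw hru hrw
    -- pick `a ∈ X \ Y` and `b ∈ Y \ X`
    obtain ⟨a, ha⟩ := Finset.card_pos.mp (by omega : 0 < (X \ Y).card)
    have hYX : (Y \ X).card = n + 1 := by
      have h1 := Finset.card_sdiff (s := Y) (t := X)
      have h2 := Finset.card_sdiff (s := X) (t := Y)
      rw [Finset.inter_comm] at h1
      omega
    obtain ⟨b, hb⟩ := Finset.card_pos.mp (by omega : 0 < (Y \ X).card)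
    rw [Finset.mem_sdiff] at ha hb
    have haC : a ∈ C := hXC ha.1
    have hbC : b ∈ C := hYC hb.1
    have hab : a ≠ b := fun h' => hb.2 (h' ▸ ha.1)
    -- the case `s = 0`: two rows, a star leaf
    rcases Nat.eq_zero_or_pos s with hs0 | hspos
    · subst hs0
      have hr : r ≤ h + (n + 1) + 1 := by
        have hball : (C.powerset.filter fun U => U.card ≤ 0) ⊆ {∅} := by
          intro U hU
          rw [mem_ballF] at hU
          rw [Finset.mem_singleton]
          exact Finset.card_eq_zero.mp (Nat.le_zero.mp hU.2)
        have hF : (insert X (C.powerset.filter fun U => U.card ≤ 0)).card ≤ 2 := by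
          calc (insert X (C.powerset.filter fun U => U.card ≤ 0)).card
              ≤ (C.powerset.filter fun U => U.card ≤ 0).card + 1 := Finset.card_insert_le _ _
            _ ≤ ({∅} : Finset (Finset (Fin h))).card + 1 := by gcongr
            _ = 2 := by simp
        have hru' : ∀ i ∈ (Finset.univ : Finset (Fin r)), u i ∈ insert X (C.powerset.filter fun U => U.card ≤ 0) := by
          intro i _
          have := Set.mem_range_self (f := u) i
          rw [hru] at this
          exact this
        have := Finset.card_le_card_of_injOn u hru' (hu.injOn)
        rw [Finset.card_univ, Fintype.card_fin] at this
        omega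
      exact fullJoinCube_of_le u w hu hw hr
    -- the case `s = s' + 1`
    obtain ⟨s', rfl⟩ : ∃ s', s = s' + 1 := ⟨s - 1, by omega⟩
    set σ : Equiv.Perm (Fin h) := Equiv.swap a b with hσ
    -- the four families
    set FDa : Finset (Finset (Fin h)) := (C.erase a).powerset.filter fun U => U.card ≤ s' + 1 with hFDa
    set FDb : Finset (Finset (Fin h)) := (C.erase b).powerset.filter fun U => U.card ≤ s' + 1 with hFDb
    set FLa : Finset (Finset (Fin h)) := insert (X.erase a) ((C.erase a).powerset.filter fun U => U.card ≤ s') with hFLa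
    set FLb : Finset (Finset (Fin h)) := insert (Y.erase b) ((C.erase b).powerset.filter fun U => U.card ≤ s') with hFLb
    set FLa' : Finset (Finset (Fin h)) := insert (Y.erase b) ((C.erase a).powerset.filter fun U => U.card ≤ s') with hFLa'
    -- relabelling by the transposition `(a b)`
    have hswap : (C.erase b).map σ.toEmbedding = C.erase a := map_swap_erase C a b haC hbC
    have hswap' : (C.erase a).map σ.toEmbedding = C.erase b := by
      rw [hσ, Equiv.swap_comm]; exact map_swap_erase C b a hbC haC
    have hYb : (Y.erase b).map σ.toEmbedding = Y.erase b :=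
      map_swap_of_notMem _ a b (fun h' => ha.2 (Finset.mem_of_mem_erase h')) (Finset.notMem_erase b Y)
    have hmapD : FDa.map (Finset.mapEmbedding σ.toEmbedding).toEmbedding = FDb := by
      rw [hFDa, map_ballF, hswap']
    have hmapL : FLa'.map (Finset.mapEmbedding σ.toEmbedding).toEmbedding = FLb := by
      rw [hFLa', hFLb, Finset.map_insert, map_ballF, hswap']
      simp only [RelEmbedding.coe_toEmbedding, Finset.mapEmbedding_apply, hYb]
    -- cardinalities
    have hXa : (X.erase a).card = s' + 1 := by rw [Finset.card_erase_of_mem ha.1]; omega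
    have hYb' : (Y.erase b).card = s' + 1 := by rw [Finset.card_erase_of_mem hb.1]; omega
    have hXa_nm : X.erase a ∉ ((C.erase a).powerset.filter fun U => U.card ≤ s') := by
      rw [mem_ballF]; omega
    have hYb_nm : Y.erase b ∉ ((C.erase a).powerset.filter fun U => U.card ≤ s') := by
      rw [mem_ballF]; omega
    have hcardD : FDb.card = FDa.card := by rw [← hmapD, Finset.card_map]
    have hcardL' : FLa'.card = FLa.card := by
      rw [hFLa', hFLa, Finset.card_insert_of_notMem hXa_nm, Finset.card_insert_of_notMem hYb_nm]
    have hcardL : FLb.card = FLa.card := by rw [← hmapL, Finset.card_map, hcardL']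
    -- enumerations
    obtain ⟨uD, huD, hruD⟩ := exists_enum FDa
    obtain ⟨wD, hwD, hrwD⟩ : ∃ e : Fin FDa.card → Finset (Fin h), Function.Injective e ∧ Set.range e = ↑FDb := by
      rw [← hcardD]; exact exists_enum FDb
    obtain ⟨uL, huL, hruL⟩ := exists_enum FLa
    obtain ⟨wL, hwL, hrwL⟩ : ∃ e : Fin FLa.card → Finset (Fin h), Function.Injective e ∧ Set.range e = ↑FLb := by
      rw [← hcardL]; exact exists_enum FLb
    obtain ⟨wL', hwL', hrwL'⟩ : ∃ e : Fin FLa.card → Finset (Fin h), Function.Injective e ∧ Set.range e = ↑FLa' := by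
      rw [← hcardL']; exact exists_enum FLa'
    -- the step
    refine fullJoinCube_step_of_ranges u w hu hw ?_ a b uD wD uL wL huD hwD huL hwL ?_ ?_ ?_ ?_ ?_ ?_
    · rw [hru]; exact isLowerSet_firstShell C X (s' + 1) hXC hX
    · rw [hruD, hru, hFDa]; exact (deletion_firstShell C X (s' + 1) a ha.1).symm
    · rw [hrwD, hrw, hFDb]; exact (deletion_firstShell C Y (s' + 1) b hb.1).symm
    · rw [hruL, hru, hFLa]; exact (link_firstShell C X s' a ha.1 hXC).symm
    · rw [hrwL, hrw, hFLb]; exact (link_firstShell C Y s' b hb.1 hYC).symm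
    · -- deletion pair: diagonal + relabel, then pad
      have H0 := fullJoinCube_diagK uD huD
      have H1 := fullJoinCube_relabel_range σ uD uD wD huD hwD (by
        rw [hrwD, hruD, ← coe_map_mapEmbedding, hmapD]) H0
      exact fullJoinCube_pad_le uD wD (by omega : h ≤ h + n) H1
    · -- link pair: induction hypothesis + relabel
      have hXaC : X.erase a ⊆ C.erase a := Finset.erase_subset_erase a hXC
      have hYbC : Y.erase b ⊆ C.erase a := by
        intro y hy
        rw [Finset.mem_erase] at hy ⊢
        exact ⟨fun h' => ha.2 (h' ▸ hy.2), hYC hy.2⟩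
      have hdiff : ((X.erase a) \ (Y.erase b)).card = n := by
        have hset : (X.erase a) \ (Y.erase b) = (X \ Y).erase a := by
          ext x
          simp only [Finset.mem_sdiff, Finset.mem_erase, not_and]
          constructor
          · rintro ⟨⟨hxa, hxX⟩, himp⟩
            refine ⟨hxa, hxX, fun hxY => ?_⟩
            have := himp (fun h' => hb.2 (h' ▸ hxX))
            exact absurd this (by intro h'; exact h' hxY |>.elim)
          · rintro ⟨hxa, hxX, hxY⟩
            exact ⟨⟨hxa, hxX⟩, fun _ hxY' => absurd hxY' hxY⟩
        rw [hset, Finset.card_erase_of_mem (Finset.mem_sdiff.mpr ha), hXY]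
        rfl
      have H2 := ih s' (C.erase a) (X.erase a) (Y.erase b) hXaC hYbC hXa hYb' hdiff FLa.card uL wL' huL hwL'
        (by rw [hruL]) (by rw [hrwL'])
      exact fullJoinCube_relabel_range σ uL wL' wL huL hwL (by
        rw [hrwL, hrwL', ← coe_map_mapEmbedding, hmapL]) H2


/-! ## 3. Through the door: first-shell layouts are hit by a polynomial of `SmallCircuits ℂ (h+h) 8` -/

/-- One-cube bridge to the door (p672458): a nonsingular one-cube full hidden sum with `K ≤ h³` states (`h ≥ 3`) yields a polynomial of
`SmallCircuits ℂ (h + h) 8` whose partition matrix on `(u, w)` is nonsingular. -/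
theorem partitionMinor_hit_of_oneCube {r : ℕ} (hh : 3 ≤ h) (hK : K ≤ h * h * h) (u w : Fin r → Finset (Fin h))
    (H : ∃ (tx ty : Option (Fin K) → Fin h → ℂ) (lam : Fin K → ℂ),
      (Matrix.of fun i j : Fin r => ∑ J : Finset (Fin K), (∏ q ∈ J, lam q) *
        ((∏ a ∈ u i, (tx none a + ∑ q ∈ J, tx (some q) a)) * ∏ c ∈ w j, (ty none c + ∑ q ∈ J, ty (some q) c))).det ≠ 0) :
    ∃ f ∈ Literature.Barriers.ValiantsHypothesis.SmallCircuits ℂ (h + h) 8,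
      (Matrix.of fun i j : Fin r => MvPolynomial.coeff
        (∑ a ∈ u i, Finsupp.single (Fin.castAdd h a) 1 +
          ∑ c ∈ w j, Finsupp.single (Fin.natAdd h c) 1) f).det ≠ 0 := by
  obtain ⟨tx, ty, lam, hdet⟩ := H
  refine partitionMinor_hit_of_fullJoin_mem h 1 K r hh (by omega) hK u w (fun _ => tx) (fun _ => ty) (fun _ => 1)
    (fun _ => lam) ?_
  have hmat : (Matrix.of fun i j : Fin r => ∑ p : Fin 1, ∑ J : Finset (Fin K),
      (fun _ : Fin 1 => (1 : ℂ)) p * (∏ k ∈ J, (fun _ : Fin 1 => lam) p k) *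
      ((∏ a ∈ u i, ((fun _ : Fin 1 => tx) p none a + ∑ q ∈ J, (fun _ : Fin 1 => tx) p (some q) a)) *
        ∏ c ∈ w j, ((fun _ : Fin 1 => ty) p none c + ∑ q ∈ J, (fun _ : Fin 1 => ty) p (some q) c))) =
      Matrix.of fun i j : Fin r => ∑ J : Finset (Fin K), (∏ k ∈ J, lam k) *
        ((∏ a ∈ u i, (tx none a + ∑ q ∈ J, tx (some q) a)) *
          ∏ c ∈ w j, (ty none c + ∑ q ∈ J, ty (some q) c)) := by
    refine Matrix.ext fun i j => ?_
    simp only [Matrix.of_apply, Fin.sum_univ_one, one_mul]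
  rw [hmat]
  exact hdet

/-- **Every first-shell layout is hit** (item 19717's conclusion with `b = 8`, for this infinite family of NON-ISOMORPHIC lower pairs): for
`h ≥ 3`, `X, Y ⊆ C` of size `s + 1` and any injective enumerations `u`, `w` of `B_s(C) ∪ {X}`, `B_s(C) ∪ {Y}`, some
`f ∈ SmallCircuits ℂ (h + h) 8` has `det [coeff_{x^{u i} y^{w j}} f] ≠ 0`. -/
theorem partitionMinor_hit_firstShell {r : ℕ} (hh : 3 ≤ h) (s : ℕ) (C X Y : Finset (Fin h)) (hXC : X ⊆ C) (hYC : Y ⊆ C)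
    (hX : X.card = s + 1) (hY : Y.card = s + 1) (u w : Fin r → Finset (Fin h)) (hu : Function.Injective u)
    (hw : Function.Injective w) (hru : Set.range u = ↑(insert X (C.powerset.filter fun U => U.card ≤ s)))
    (hrw : Set.range w = ↑(insert Y (C.powerset.filter fun U => U.card ≤ s))) :
    ∃ f ∈ Literature.Barriers.ValiantsHypothesis.SmallCircuits ℂ (h + h) 8,
      (Matrix.of fun i j : Fin r => MvPolynomial.coeff
        (∑ a ∈ u i, Finsupp.single (Fin.castAdd h a) 1 +
          ∑ c ∈ w j, Finsupp.single (Fin.natAdd h c) 1) f).det ≠ 0 := by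
  have hn : (X \ Y).card ≤ h :=
    calc (X \ Y).card ≤ X.card := Finset.card_le_card Finset.sdiff_subset
      _ ≤ Fintype.card (Fin h) := Finset.card_le_univ X
      _ = h := Fintype.card_fin h
  refine partitionMinor_hit_of_oneCube hh ?_ u w
    (fullJoinCube_firstShell (X \ Y).card s C X Y hXC hYC hX hY rfl r u w hu hw hru hrw)
  calc h + (X \ Y).card ≤ h + h := by omega
    _ ≤ h * h := by nlinarith
    _ = h * h * 1 := by ring
    _ ≤ h * h * h := by gcongr; omega

end FullJoin

end

end Summit.ValiantsHypothesis.ValiantsHypothesis.Theorems.BarrierLever.HiddenStates
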